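import Summits.NavierStokesRegularity.NavierStokesRegularity.Theorems.CoriolisHeadFarFieldCovariance
import HarnessLib

/-!
LANDING NOTE (ns-k2-port-2 g0, firing typer g21's plate sha16 382061e2ed78b9c0 per DIRECTOR-NS #123): file 2/2 of the plate (400-line limit) — §2 `profile_scaling`,
§3 `profile_conj`, §4 P2′ `decayingRotatedLiouville_of_pineauVicolFrame` + converse + `…_iff_…`; §0–§1 (skew normal form, P1) = `…Theorems.CoriolisHeadFarFieldCovariance`
(imported; it carries the plate's Literature imports).  Declarations byte-identical to the plate except ONE deprecation rename inside a proof
(`EuclideanSpace.norm_single` → `PiLp.norm_single`, Mathlib 2026-03-15; the tree builds with 0 warnings); the module docstring below is the plate's, verbatim.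
-/

/-!
# Route CoriolisHead · crux `NoCoRotatingCore` (stmt-NavierStokesRegularity-22676) — line «far-field-constancy»:
# TRANSLATION COVARIANCE (P1) and the PINEAU–VICOL FRAME REDUCTION (P2′) of the rotated Leray profile system

Support file (`--supports stmt-NavierStokesRegularity-22676 --as helper`; theorems only, no definitions, no
named facts), prepared by the typer seat nsreg-typer g21 (cell ns-regularity-ideate) on DIRECTOR-NS g11 #109 for
the line `Cruxes/NoCoRotatingCore/Lines/far_field_constancy.lean` of ns-idea-10 g0 (skeleton dfea78de5840;
critic idea-crit-8 PASS-WITH-PRICE 2026-08-28T02:56Z).  The line's skeleton has `sorry`d stubs and is not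
importable, so the two statements below are RESTATED VERBATIM (binders, order, spelling) from it.

THE SYSTEM (Pineau–Vicol (1.8a) with `αJ ↦ B`, any `ν, a > 0`, any skew `B`):
`−νΔU + aU + a(y·∇)U + (BU − (By·∇)U) + (U·∇)U + ∇P = 0`, `div U = 0` on `ℝ³`.

* `farField_translationCovariance` = the line's stub **`stub_translationCovariance` (P1) VERBATIM, PROVED**:
  if `‖U y − b‖ ≤ K/(1+‖y‖)` then for the (unique) `y₀` with `a y₀ − B y₀ = −b` the recentred field
  `y ↦ U (y + y₀) − b` solves the same system with pressure `y ↦ P (y + y₀) + ⟪a b + B b, y⟫` and decays like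
  `K(1+‖y₀‖)/(1+‖y‖)`.  (`⟨(aI − B)y, y⟩ = a‖y‖²` gives injectivity hence surjectivity of `aI − B`; the extra
  terms are `ab + Bb = ∇⟪ab + Bb, ·⟫` and `DŨ[a y₀ − B y₀ + b] = 0`; `1+‖y‖ ≤ (1+‖y₀‖)(1+‖y+y₀‖)`.)
* `decayingRotatedLiouville_of_pineauVicolFrame` = the critic's price **P2′**: the line's residual
  `stub_decayingRotatedLiouville` (R1: decaying smooth rotated profiles vanish, EVERY `ν, a > 0`, EVERY skew `B`)
  FOLLOWS from Pineau–Vicol's Conjecture 1.1 AS PRINTED — profile form, frame `(ν, a, B) = (1, ½, αJ)`,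
  `J = R′(0)` the generator of the rotations about `e₃` ((1.6); tree `Literature.Analysis.FluidPDE.rotGenL`),
  `α ≠ 0`: «let `α ≠ 0` and `U` a smooth solution of (1.8) on `ℝ³`; if `|U(y)| ≤ C/(1+|y|)` then `U ≡ 0`»
  [arXiv:2607.09619 p. 3, (1.8a) `α(JU − (Jy·∇)U) + ½U + ½(y·∇)U − ΔU + (U·∇)U + ∇P = 0`, (1.8b) `∇·U = 0`].
  Proof: parabolic scaling `W(z) = cU(λz)`, `Q(z) = c²P(λz)`, `λ = √(ν/2a)`, `c = 1/(2aλ)` takes `(ν, a, B)` to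
  `(1, ½, B/2a)`; a real skew `B′` on `ℝ³` has a kernel vector (`det B′ = det(−B′ᵀ) = −det B′`), and in an
  orthonormal basis `(f₁, f₂, e)` with `B′e = 0` one has `B′f₁ = αf₂`, `B′f₂ = −αf₁`, so the isometry
  `R : fᵢ ↦ eᵢ` conjugates `B′` to `αJ`; the system is covariant under `U ↦ R ∘ U ∘ R⁻¹`, `P ↦ P ∘ R⁻¹`
  (tree `IsometryInvariance`: `fderiv/convect/divergence/gradient/laplacian_conj_linearIsometryEquiv`); the
  case `α = 0` (i.e. `B = 0`) is Tsai's theorem in the tree (`IsLerayProfile.exists_eq_const_of_bounded` +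
  decay).  With the converse `pineauVicolFrame_of_decayingRotatedLiouville` (instantiate `ν = 1, a = ½,
  B = αJ`): **R1 ⟺ Conjecture 1.1 as printed** (`decayingRotatedLiouville_iff_pineauVicolFrame`), so the
  line's residual is exactly the printed open problem, not a strengthening of it.

HONEST FRAMING.  Nothing here proves `stub_farFieldConstancy` (K1, the line's crux), `NoCoRotatingCore`,
Pineau–Vicol's Conjecture 1.1, or Navier–Stokes regularity: these are bookkeeping lemmas (change of origin,
of scale and of axes) of a REDUCTION of one crux to a printed conjecture.  WHAT THIS IS NOT: not 22676, not K1,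
NOT NS regularity.  bears_on: stmt-NavierStokesRegularity-22676 (line far-field-constancy: P1, P2′).

References: B. Pineau, V. Vicol, arXiv:2607.09619 (2026), (1.6)–(1.9), Conjecture 1.1 [PineauVicol2026];
T.-P. Tsai, ARMA 143 (1998), Thm 1 [Tsai1998]; A. Majda, A. Bertozzi, *Vorticity and Incompressible Flow*
(CUP 2002), §1.2 Prop. 1.1 (symmetry groups) [MajdaBertozziCUP2002].
-/

noncomputable section

-- the summit and its single sub-problem share the name (CONVENTIONS §1), as in every Theorems file
set_option linter.dupNamespace false

open Set Function Module
open scoped RealInnerProductSpace Laplacian ContDiff BigOperators InnerProductSpace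
open Literature.Analysis.FluidPDE

namespace Summit.NavierStokesRegularity.NavierStokesRegularity.Theorems.CoriolisHead

/-! ### §2 Parabolic scaling: `(ν, a, B) ↦ (1, ½, B/2a)` -/

section Scaling

/-- `∇(k P(c ·))(x) = (k c) • (∇P)(c x)`, no differentiability hypothesis. [folklore] -/
theorem gradient_const_mul_comp_smul' (P : EuclideanSpace ℝ (Fin 3) → ℝ) (k c : ℝ)
    (x : EuclideanSpace ℝ (Fin 3)) :
    gradient (fun y => k * P (c • y)) x = (k * c) • gradient P (c • x) := by
  have h : (fun y => k * P (c • y)) = fun y => k • P (c • y) := rfl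
  rw [h, gradient, fderiv_const_smul_comp_smul_apply P k c x, map_smul, gradient]

/-- `div (k U(c ·))(x) = (k c) div U (c x)`, no differentiability hypothesis. [folklore] -/
theorem divergence_const_smul_comp_smul' (U : EuclideanSpace ℝ (Fin 3) → EuclideanSpace ℝ (Fin 3))
    (k c : ℝ) (x : EuclideanSpace ℝ (Fin 3)) :
    VectorCalculus.divergence (fun y => k • U (c • y)) x =
      (k * c) * VectorCalculus.divergence U (c • x) := by
  simp only [VectorCalculus.divergence, fderiv_const_smul_comp_smul_apply U k c x,
    ContinuousLinearMap.toLinearMap_smul, map_smul, smul_eq_mul]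

/-- **Parabolic scaling of the rotated Leray profile system.**  If `(U, P)` solves the system with
parameters `(ν, a, B)`, then `W(z) = c U(λz)`, `Q(z) = c² P(λz)` with `λ = √(ν/2a)`, `c = 1/(2aλ)` solve it
with `(1, ½, B/2a)` (the whole equation is multiplied by `c/2a`); smoothness, incompressibility and the Type-I
decay `K/(1+‖·‖)` are preserved.  [folklore; cf. Pineau–Vicol 2026 (1.7)–(1.8), Tsai 1998 §3.3 «we may assume ν = 1»] -/
theorem profile_scaling {ν a : ℝ} (hν : 0 < ν) (ha : 0 < a)
    {B : EuclideanSpace ℝ (Fin 3) →L[ℝ] EuclideanSpace ℝ (Fin 3)}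
    {U : EuclideanSpace ℝ (Fin 3) → EuclideanSpace ℝ (Fin 3)} {P : EuclideanSpace ℝ (Fin 3) → ℝ}
    (hU : ContDiff ℝ (⊤ : ℕ∞) U) (hP : ContDiff ℝ 2 P)
    (hdiv : Literature.Analysis.FluidPDE.VectorCalculus.IsDivFree U)
    (heq : ∀ y, -(ν • Laplacian.laplacian U y) + a • U y + a • fderiv ℝ U y y
      + (B (U y) - fderiv ℝ U y (B y)) + Literature.Analysis.FluidPDE.convect U U y
      + gradient P y = 0)
    (hdec : ∃ K : ℝ, ∀ y, ‖U y‖ ≤ K / (1 + ‖y‖)) :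
    ∃ lam c : ℝ, 0 < lam ∧ 0 < c ∧
      ContDiff ℝ (⊤ : ℕ∞) (fun z => c • U (lam • z)) ∧
      ContDiff ℝ 2 (fun z => c ^ 2 * P (lam • z)) ∧
      Literature.Analysis.FluidPDE.VectorCalculus.IsDivFree (fun z => c • U (lam • z)) ∧
      (∀ z, -((1 : ℝ) • Laplacian.laplacian (fun z => c • U (lam • z)) z)
        + (1 / 2 : ℝ) • (fun z => c • U (lam • z)) z
        + (1 / 2 : ℝ) • fderiv ℝ (fun z => c • U (lam • z)) z z
        + (((2 * a)⁻¹ • B) ((fun z => c • U (lam • z)) z)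
            - fderiv ℝ (fun z => c • U (lam • z)) z (((2 * a)⁻¹ • B) z))
        + Literature.Analysis.FluidPDE.convect (fun z => c • U (lam • z)) (fun z => c • U (lam • z)) z
        + gradient (fun z => c ^ 2 * P (lam • z)) z = 0) ∧
      (∃ K' : ℝ, ∀ z, ‖(fun z => c • U (lam • z)) z‖ ≤ K' / (1 + ‖z‖)) := by
  set lam : ℝ := Real.sqrt (ν / (2 * a)) with hlam_def
  have hlam : 0 < lam := Real.sqrt_pos.2 (by positivity)
  have hlam2 : lam ^ 2 = ν / (2 * a) := Real.sq_sqrt (by positivity)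
  set c : ℝ := 1 / (2 * a * lam) with hc_def
  have hc : 0 < c := by positivity
  refine ⟨lam, c, hlam, hc, ?_, ?_, ?_, ?_, ?_⟩
  · exact (hU.comp (contDiff_const_smul lam)).const_smul c
  · exact contDiff_const.mul (hP.comp (contDiff_const_smul lam))
  · intro z
    rw [divergence_const_smul_comp_smul', hdiv (lam • z), mul_zero]
  · intro z
    have hΔ : Laplacian.laplacian (fun z => c • U (lam • z)) z
        = (c * lam ^ 2) • Laplacian.laplacian U (lam • z) :=
      laplacian_const_smul_comp_smul U c hlam.ne' z
    have hfd : fderiv ℝ (fun z => c • U (lam • z)) z = (c * lam) • fderiv ℝ U (lam • z) :=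
      fderiv_const_smul_comp_smul_apply U c lam z
    have hgr : gradient (fun z => c ^ 2 * P (lam • z)) z = (c ^ 2 * lam) • gradient P (lam • z) :=
      gradient_const_mul_comp_smul' P (c ^ 2) lam z
    rw [hΔ, convect_apply, hfd, hgr]
    have key := congrArg (fun v => (c / (2 * a)) • v) (heq (lam • z))
    simp only [smul_zero] at key
    rw [← key]
    simp only [convect_apply, map_smul, _root_.smul_apply, smul_add, smul_sub, smul_neg, smul_smul]
    have e1 : (1 : ℝ) * (c * lam ^ 2) = c / (2 * a) * ν := by
      rw [hlam2]; field_simp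
    have e2 : (1 / 2 : ℝ) * c = c / (2 * a) * a := by field_simp
    have e3 : (1 / 2 : ℝ) * (c * lam) = c / (2 * a) * (a * lam) := by field_simp
    have e4 : c * (2 * a)⁻¹ = c / (2 * a) := by field_simp
    have e5 : (2 * a)⁻¹ * (c * lam) = c / (2 * a) * lam := by field_simp
    have e6 : c * (c * lam) = c / (2 * a) := by
      rw [hc_def]; field_simp
    have e7 : c ^ 2 * lam = c / (2 * a) := by
      rw [hc_def]; field_simp
    rw [e1, e2, e3, e4, e5, e6, e7]
  · obtain ⟨K, hK⟩ := hdec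
    have hK0 : 0 ≤ K := by
      have h := hK 0
      rw [norm_zero, add_zero, div_one] at h
      exact (norm_nonneg _).trans h
    set m : ℝ := min 1 lam with hm
    have hm0 : 0 < m := lt_min one_pos hlam
    refine ⟨c * K / m, fun z => ?_⟩
    have h1 : ‖c • U (lam • z)‖ = c * ‖U (lam • z)‖ := by
      rw [norm_smul, Real.norm_of_nonneg hc.le]
    have h2 : ‖U (lam • z)‖ ≤ K / (1 + lam * ‖z‖) := by
      have := hK (lam • z)
      rwa [norm_smul, Real.norm_of_nonneg hlam.le] at this
    have h3 : m * (1 + ‖z‖) ≤ 1 + lam * ‖z‖ := by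
      have := min_le_left (1 : ℝ) lam
      have := min_le_right (1 : ℝ) lam
      nlinarith [norm_nonneg z]
    have hpos : 0 < m * (1 + ‖z‖) := by positivity
    show ‖c • U (lam • z)‖ ≤ c * K / m / (1 + ‖z‖)
    rw [h1, div_div, mul_comm m]
    calc c * ‖U (lam • z)‖ ≤ c * (K / (1 + lam * ‖z‖)) := mul_le_mul_of_nonneg_left h2 hc.le
      _ = c * K / (1 + lam * ‖z‖) := by ring
      _ ≤ c * K / ((1 + ‖z‖) * m) := by
          rw [mul_comm (1 + ‖z‖) m]
          exact div_le_div_of_nonneg_left (by positivity) hpos h3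

end Scaling

/-! ### §3 Rotation covariance: `(U, P, B) ↦ (R U R⁻¹, P ∘ R⁻¹, R B R⁻¹)` -/

section Conjugation

/-- **Rotation covariance of the rotated Leray profile system** (Majda–Bertozzi Prop. 1.1 (iii) for the
profile system): for a linear isometry `R`, `X = R ∘ U ∘ R⁻¹`, `S = P ∘ R⁻¹` solve the system with the
conjugated frame `R B R⁻¹`, same `ν, a`; smoothness, incompressibility and the decay `K/(1+‖·‖)` are preserved.
[cite: MajdaBertozziCUP2002, §1.2 Prop. 1.1 (iii)] -/
theorem profile_conj (R : EuclideanSpace ℝ (Fin 3) ≃ₗᵢ[ℝ] EuclideanSpace ℝ (Fin 3)) {ν a : ℝ}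
    {B : EuclideanSpace ℝ (Fin 3) →L[ℝ] EuclideanSpace ℝ (Fin 3)}
    {U : EuclideanSpace ℝ (Fin 3) → EuclideanSpace ℝ (Fin 3)} {P : EuclideanSpace ℝ (Fin 3) → ℝ}
    (hU : ContDiff ℝ (⊤ : ℕ∞) U) (hP : ContDiff ℝ 2 P)
    (hdiv : Literature.Analysis.FluidPDE.VectorCalculus.IsDivFree U)
    (heq : ∀ y, -(ν • Laplacian.laplacian U y) + a • U y + a • fderiv ℝ U y y
      + (B (U y) - fderiv ℝ U y (B y)) + Literature.Analysis.FluidPDE.convect U U y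
      + gradient P y = 0)
    (hdec : ∃ K : ℝ, ∀ y, ‖U y‖ ≤ K / (1 + ‖y‖)) :
    ContDiff ℝ (⊤ : ℕ∞) (fun w => R (U (R.symm w))) ∧
      ContDiff ℝ 2 (fun w => P (R.symm w)) ∧
      Literature.Analysis.FluidPDE.VectorCalculus.IsDivFree (fun w => R (U (R.symm w))) ∧
      (∀ w, -(ν • Laplacian.laplacian (fun w => R (U (R.symm w))) w)
        + a • (fun w => R (U (R.symm w))) w
        + a • fderiv ℝ (fun w => R (U (R.symm w))) w w
        + (R (B (R.symm ((fun w => R (U (R.symm w))) w)))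
            - fderiv ℝ (fun w => R (U (R.symm w))) w (R (B (R.symm w))))
        + Literature.Analysis.FluidPDE.convect (fun w => R (U (R.symm w))) (fun w => R (U (R.symm w))) w
        + gradient (fun w => P (R.symm w)) w = 0) ∧
      (∃ K : ℝ, ∀ w, ‖(fun w => R (U (R.symm w))) w‖ ≤ K / (1 + ‖w‖)) := by
  refine ⟨?_, ?_, hdiv.conj_linearIsometryEquiv R, ?_, ?_⟩
  · exact R.toContinuousLinearEquiv.contDiff.comp (hU.comp R.symm.toContinuousLinearEquiv.contDiff)
  · exact hP.comp R.symm.toContinuousLinearEquiv.contDiff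
  · intro w
    set v := R.symm w with hv
    rw [laplacian_conj_linearIsometryEquiv, fderiv_conj_linearIsometryEquiv, convect_conj_linearIsometryEquiv,
      gradient_comp_linearIsometryEquiv_symm]
    have key := congrArg R (heq v)
    rw [map_zero] at key
    rw [← key]
    simp [hv, map_add, map_sub, map_smul]
  · obtain ⟨K, hK⟩ := hdec
    refine ⟨K, fun w => ?_⟩
    show ‖R (U (R.symm w))‖ ≤ K / (1 + ‖w‖)
    rw [LinearIsometryEquiv.norm_map]
    have h := hK (R.symm w)
    rwa [LinearIsometryEquiv.norm_map] at h

end Conjugation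

/-! ### §4 P2′ — the line's residual R1 versus Pineau–Vicol's Conjecture 1.1 AS PRINTED -/

section PineauVicolFrame

/-- **R1 ⇒ Conjecture 1.1 (profile form, as printed).**  The line's residual `stub_decayingRotatedLiouville`
(every `ν, a > 0`, every skew `B`) specialises to the printed frame `(ν, a, B) = (1, ½, αJ)`:
«let `α ≠ 0` and `U` a smooth solution of (1.8a) `α(JU − (Jy·∇)U) + ½U + ½(y·∇)U − ΔU + (U·∇)U + ∇P = 0`,
(1.8b) `∇·U = 0`; if `|U(y)| ≤ C/(1+|y|)` then `U ≡ 0`» (`J = rotGen`, (1.6)).  (The pressure is quantified as a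
`C²` function; since `∇P` is a smooth expression in `U` this is the printed class.)
[cite: PineauVicol2026, Conjecture 1.1 with (1.6), (1.8)–(1.9) (arXiv:2607.09619 p. 3)] -/
theorem pineauVicolFrame_of_decayingRotatedLiouville
    (h : ∀ (ν a : ℝ), 0 < ν → 0 < a →
      ∀ (B : EuclideanSpace ℝ (Fin 3) →L[ℝ] EuclideanSpace ℝ (Fin 3))
        (U : EuclideanSpace ℝ (Fin 3) → EuclideanSpace ℝ (Fin 3)) (P : EuclideanSpace ℝ (Fin 3) → ℝ),
      ContDiff ℝ (⊤ : ℕ∞) U → ContDiff ℝ 2 P → (∀ x, inner ℝ (B x) x = 0) →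
      Literature.Analysis.FluidPDE.VectorCalculus.IsDivFree U →
      (∀ y, -(ν • Laplacian.laplacian U y) + a • U y + a • fderiv ℝ U y y
        + (B (U y) - fderiv ℝ U y (B y)) + Literature.Analysis.FluidPDE.convect U U y
        + gradient P y = 0) →
      (∃ K : ℝ, ∀ y, ‖U y‖ ≤ K / (1 + ‖y‖)) →
      ∀ y, U y = 0) :
    ∀ α : ℝ, α ≠ 0 →
      ∀ (U : EuclideanSpace ℝ (Fin 3) → EuclideanSpace ℝ (Fin 3)) (P : EuclideanSpace ℝ (Fin 3) → ℝ),
      ContDiff ℝ (⊤ : ℕ∞) U → ContDiff ℝ 2 P →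
      Literature.Analysis.FluidPDE.VectorCalculus.IsDivFree U →
      (∀ y, α • (rotGen (U y) - fderiv ℝ U y (rotGen y)) + (1 / 2 : ℝ) • U y
        + (1 / 2 : ℝ) • fderiv ℝ U y y - Laplacian.laplacian U y
        + Literature.Analysis.FluidPDE.convect U U y + gradient P y = 0) →
      (∃ K : ℝ, ∀ y, ‖U y‖ ≤ K / (1 + ‖y‖)) →
      ∀ y, U y = 0 := by
  intro α _hα U P hU hP hdiv heq hdec
  refine h 1 (1 / 2) one_pos (by norm_num) (α • rotGenL) U P hU hP (fun x => ?_) hdiv (fun y => ?_) hdec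
  · rw [_root_.smul_apply, rotGenL_apply, inner_smul_left, inner_rotGen_self, mul_zero]
  · have e : -((1 : ℝ) • Laplacian.laplacian U y) + (1 / 2 : ℝ) • U y + (1 / 2 : ℝ) • fderiv ℝ U y y
        + ((α • rotGenL) (U y) - fderiv ℝ U y ((α • rotGenL) y))
        + Literature.Analysis.FluidPDE.convect U U y + gradient P y
        = α • (rotGen (U y) - fderiv ℝ U y (rotGen y)) + (1 / 2 : ℝ) • U y
          + (1 / 2 : ℝ) • fderiv ℝ U y y - Laplacian.laplacian U y
          + Literature.Analysis.FluidPDE.convect U U y + gradient P y := by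
      rw [_root_.smul_apply, _root_.smul_apply, rotGenL_apply, rotGenL_apply, map_smul, one_smul, smul_sub]
      abel
    rw [e]
    exact heq y

/-- **P2′ — Conjecture 1.1 AS PRINTED ⇒ the line's residual R1 in the general frame.**  If rotated
self-similar profiles in Pineau–Vicol's frame `(1, ½, αJ)`, `α ≠ 0`, with the Type-I decay `C/(1+|y|)` vanish
(Conjecture 1.1, profile form), then so do smooth decaying solutions of
`−νΔU + aU + a(y·∇)U + (BU − (By·∇)U) + (U·∇)U + ∇P = 0`, `div U = 0` for EVERY `ν, a > 0` and EVERY skew `B`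
— the statement of the line's stub `stub_decayingRotatedLiouville` VERBATIM.  Proof: parabolic scaling to
`(1, ½, B/2a)` (`profile_scaling`), skew normal form `R (B/2a) R⁻¹ = αJ` (`exists_linearIsometryEquiv_conj_eq_rotGen`),
rotation covariance (`profile_conj`); the degenerate frame `α = 0 ⇔ B = 0` is Tsai's theorem (tree
`IsLerayProfile.exists_eq_const_of_bounded`, the constant being `0` by the decay).
[cite: PineauVicol2026, Conjecture 1.1, (1.6)–(1.9) (arXiv:2607.09619 p. 3); Tsai1998, Thm 1] -/
theorem decayingRotatedLiouville_of_pineauVicolFrame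
    (hPV : ∀ α : ℝ, α ≠ 0 →
      ∀ (U : EuclideanSpace ℝ (Fin 3) → EuclideanSpace ℝ (Fin 3)) (P : EuclideanSpace ℝ (Fin 3) → ℝ),
      ContDiff ℝ (⊤ : ℕ∞) U → ContDiff ℝ 2 P →
      Literature.Analysis.FluidPDE.VectorCalculus.IsDivFree U →
      (∀ y, α • (rotGen (U y) - fderiv ℝ U y (rotGen y)) + (1 / 2 : ℝ) • U y
        + (1 / 2 : ℝ) • fderiv ℝ U y y - Laplacian.laplacian U y
        + Literature.Analysis.FluidPDE.convect U U y + gradient P y = 0) →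
      (∃ K : ℝ, ∀ y, ‖U y‖ ≤ K / (1 + ‖y‖)) →
      ∀ y, U y = 0) :
    ∀ (ν a : ℝ), 0 < ν → 0 < a →
      ∀ (B : EuclideanSpace ℝ (Fin 3) →L[ℝ] EuclideanSpace ℝ (Fin 3))
        (U : EuclideanSpace ℝ (Fin 3) → EuclideanSpace ℝ (Fin 3)) (P : EuclideanSpace ℝ (Fin 3) → ℝ),
      ContDiff ℝ (⊤ : ℕ∞) U → ContDiff ℝ 2 P → (∀ x, inner ℝ (B x) x = 0) →
      Literature.Analysis.FluidPDE.VectorCalculus.IsDivFree U →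
      (∀ y, -(ν • Laplacian.laplacian U y) + a • U y + a • fderiv ℝ U y y
        + (B (U y) - fderiv ℝ U y (B y)) + Literature.Analysis.FluidPDE.convect U U y
        + gradient P y = 0) →
      (∃ K : ℝ, ∀ y, ‖U y‖ ≤ K / (1 + ‖y‖)) →
      ∀ y, U y = 0 := by
  intro ν a hν ha B U P hU hP hB hdiv heq hdec
  -- Step 1: parabolic scaling to `(1, ½, B/2a)`
  obtain ⟨lam, c, hlam, hc, hWs, hQs, hWdiv, hWeq, hWdec⟩ := profile_scaling hν ha hU hP hdiv heq hdec
  set W : EuclideanSpace ℝ (Fin 3) → EuclideanSpace ℝ (Fin 3) := fun z => c • U (lam • z) with hW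
  set Q : EuclideanSpace ℝ (Fin 3) → ℝ := fun z => c ^ 2 * P (lam • z) with hQ
  set B' : EuclideanSpace ℝ (Fin 3) →L[ℝ] EuclideanSpace ℝ (Fin 3) := (2 * a)⁻¹ • B with hB'
  have hB's : ∀ x, inner ℝ (B' x) x = 0 := fun x => by
    rw [hB', _root_.smul_apply, inner_smul_left, hB x, mul_zero]
  -- Step 2: skew normal form `R B' R⁻¹ = α J`
  obtain ⟨R, α, hconj, hα0⟩ := exists_linearIsometryEquiv_conj_eq_rotGen hB's
  -- Step 3: rotation of axes
  obtain ⟨hXs, hSs, hXdiv, hXeq, hXdec⟩ := profile_conj R hWs hQs hWdiv hWeq hWdec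
  set X : EuclideanSpace ℝ (Fin 3) → EuclideanSpace ℝ (Fin 3) := fun w => R (W (R.symm w)) with hX
  set S : EuclideanSpace ℝ (Fin 3) → ℝ := fun w => Q (R.symm w) with hS
  -- Step 4: `X ≡ 0`
  have hX0 : ∀ w, X w = 0 := by
    rcases eq_or_ne α 0 with h0 | h0
    · -- degenerate frame `B = 0`: Tsai's theorem for decaying Leray profiles
      have hB'0 : B' = 0 := hα0 h0
      have hprof : IsLerayProfile 1 (1 / 2) X S :=
        { contDiff_velocity := hXs.of_le (by norm_cast)
          contDiff_pressure := hSs.of_le (by norm_num)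
          profile_eq := fun w => by
            have h := hXeq w
            rw [hB'0] at h
            simpa using h
          divFree := hXdiv }
      obtain ⟨K, hK⟩ := hXdec
      have hbdd : ∃ M : ℝ, ∀ w, ‖X w‖ ≤ M := by
        refine ⟨|K|, fun w => (hK w).trans ?_⟩
        have h1 : K / (1 + ‖w‖) ≤ |K| / (1 + ‖w‖) :=
          div_le_div_of_nonneg_right (le_abs_self K) (by positivity)
        exact h1.trans (div_le_self (abs_nonneg K) (by linarith [norm_nonneg w]))
      obtain ⟨d, hd⟩ := hprof.exists_eq_const_of_bounded one_pos (by norm_num) hbdd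
      have hd0 : d = 0 := by
        by_contra hne
        have hdpos : 0 < ‖d‖ := norm_pos_iff.2 hne
        set t : ℝ := |K| / ‖d‖ + 1 with ht
        have htpos : 0 < t := by positivity
        set w : EuclideanSpace ℝ (Fin 3) := t • EuclideanSpace.single 0 (1 : ℝ) with hw
        have hwn : ‖w‖ = t := by
          rw [hw, norm_smul, PiLp.norm_single, norm_one, mul_one, Real.norm_of_nonneg htpos.le]
        have h1 : ‖d‖ ≤ |K| / (1 + t) := by
          have h2 := hK w
          rw [hd w, hwn] at h2
          exact h2.trans (div_le_div_of_nonneg_right (le_abs_self K) (by positivity))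
        rw [le_div_iff₀ (by positivity)] at h1
        have h3 : ‖d‖ * t = |K| + ‖d‖ := by
          rw [ht]; field_simp
        nlinarith
      intro w
      rw [hd w, hd0]
    · -- `α ≠ 0`: Pineau–Vicol's conjecture in the printed frame
      refine hPV α h0 X S hXs hSs hXdiv (fun w => ?_) hXdec
      have h := hXeq w
      rw [hconj, hconj, map_smul] at h
      have e : α • (rotGen (X w) - fderiv ℝ X w (rotGen w)) + (1 / 2 : ℝ) • X w
          + (1 / 2 : ℝ) • fderiv ℝ X w w - Laplacian.laplacian X w
          + Literature.Analysis.FluidPDE.convect X X w + gradient S w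
          = -((1 : ℝ) • Laplacian.laplacian X w) + (1 / 2 : ℝ) • X w + (1 / 2 : ℝ) • fderiv ℝ X w w
            + (α • rotGen (X w) - α • fderiv ℝ X w (rotGen w))
            + Literature.Analysis.FluidPDE.convect X X w + gradient S w := by
        rw [one_smul, smul_sub]
        abel
      rw [e]
      exact h
  -- Step 5: undo the rotation and the scaling
  have hW0 : ∀ v, W v = 0 := fun v => by
    have h := hX0 (R v)
    simp only [hX, LinearIsometryEquiv.symm_apply_apply] at h
    simpa using congrArg R.symm h
  intro y
  have h := hW0 (lam⁻¹ • y)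
  simp only [hW, smul_smul, mul_inv_cancel₀ hlam.ne', one_smul] at h
  exact (smul_eq_zero.1 h).resolve_left hc.ne'

/-- **R1 ⟺ Pineau–Vicol's Conjecture 1.1 as printed (profile form).**  The line's declared residual
`stub_decayingRotatedLiouville` (decaying smooth rotated profiles vanish for every `ν, a > 0` and every skew
frame `B`) is EQUIVALENT to the printed conjecture (frame `(1, ½, αJ)`, `α ≠ 0`): it is the printed open
problem, neither more nor less. [cite: PineauVicol2026, Conjecture 1.1 (arXiv:2607.09619 p. 3)] -/
theorem decayingRotatedLiouville_iff_pineauVicolFrame :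
    (∀ (ν a : ℝ), 0 < ν → 0 < a →
      ∀ (B : EuclideanSpace ℝ (Fin 3) →L[ℝ] EuclideanSpace ℝ (Fin 3))
        (U : EuclideanSpace ℝ (Fin 3) → EuclideanSpace ℝ (Fin 3)) (P : EuclideanSpace ℝ (Fin 3) → ℝ),
      ContDiff ℝ (⊤ : ℕ∞) U → ContDiff ℝ 2 P → (∀ x, inner ℝ (B x) x = 0) →
      Literature.Analysis.FluidPDE.VectorCalculus.IsDivFree U →
      (∀ y, -(ν • Laplacian.laplacian U y) + a • U y + a • fderiv ℝ U y y
        + (B (U y) - fderiv ℝ U y (B y)) + Literature.Analysis.FluidPDE.convect U U y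
        + gradient P y = 0) →
      (∃ K : ℝ, ∀ y, ‖U y‖ ≤ K / (1 + ‖y‖)) →
      ∀ y, U y = 0) ↔
    (∀ α : ℝ, α ≠ 0 →
      ∀ (U : EuclideanSpace ℝ (Fin 3) → EuclideanSpace ℝ (Fin 3)) (P : EuclideanSpace ℝ (Fin 3) → ℝ),
      ContDiff ℝ (⊤ : ℕ∞) U → ContDiff ℝ 2 P →
      Literature.Analysis.FluidPDE.VectorCalculus.IsDivFree U →
      (∀ y, α • (rotGen (U y) - fderiv ℝ U y (rotGen y)) + (1 / 2 : ℝ) • U y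
        + (1 / 2 : ℝ) • fderiv ℝ U y y - Laplacian.laplacian U y
        + Literature.Analysis.FluidPDE.convect U U y + gradient P y = 0) →
      (∃ K : ℝ, ∀ y, ‖U y‖ ≤ K / (1 + ‖y‖)) →
      ∀ y, U y = 0) :=
  ⟨pineauVicolFrame_of_decayingRotatedLiouville, decayingRotatedLiouville_of_pineauVicolFrame⟩

end PineauVicolFrame

end Summit.NavierStokesRegularity.NavierStokesRegularity.Theorems.CoriolisHead

end
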